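import Summits.Ventures.PercRepro.ProfilePointedCircuitClassesInOutTriangleCross

/-!
# PercRepro — `(★_3)` AT NINE POINTS, THE BASIS CASE, I: THE PARALLEL LEMMAS AND FAMILY ONE
(p5, gen 39; `proofs/P5-GM1.md` §58 ADDENDUM 1 (2))

In the dual `R` (loopless, rank `3`, `9` points) of a nullity-`3` matroid on `9` points, with a basis
`C₀ = {f, g, k}` of `R` and `H₀ = E − C₀` spanning, write `good = {z ∈ H₀ : H₀ − z spans}` (`u₃` of §58),
`A_c = {z ∈ H₀ : z ∥ c}` and `BS = {Y ∈ C(E, 3) : Y and E − Y span}` (`= BI_3` of the primal).  The three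
families of §58 ADDENDUM 1 (2):
* `exists_family_one` — `T₁ = {C₀ − c + z : z good, C₀ − c + z spans}` (two points of `C₀`), with
  `2·#good ≤ #T₁ + #par`, `par` the good points parallel to a point of `C₀` (`two_le_of_basis_triple`: a point
  `z` is bad for at most one `c` unless it is parallel to a point of `C₀`, and then for at most two);
* families two and three are in StarNineB, the assembly `2·#good ≤ #BS + 2` in StarNineC.
-/

open scoped Matroid

namespace PercRepro.Cogirth

open Finset ThmH Skew Shadow Profile

variable {α : Type} [DecidableEq α] {R : Matroid α} [R.Finite]

section Parallel

/-- Inserting a point parallel to a point of `X` does not change the rank. -/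
theorem rk_insert_eq_of_rk_pair_eq_one (hll : ∀ x ∈ gr R, rk R {x} = 1) {a b : α} (ha : a ∈ gr R)
    (hb : b ∈ gr R) (hab : rk R {a, b} = 1) {X : Finset α} (hX : X ⊆ gr R) (haX : a ∈ X) :
    rk R (insert b X) = rk R X := by
  rw [rk_insert_parallel_eq hb ha (hll b hb) (hll a ha) (by rw [pair_comm]; exact hab) hX, insert_eq_of_mem haX]

/-- Two points parallel to a third are parallel (submodularity). -/
theorem rk_pair_le_one_of_parallel (hll : ∀ x ∈ gr R, rk R {x} = 1) {a b z : α} (hz : z ∈ gr R)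
    (haz : rk R {a, z} = 1) (hbz : rk R {b, z} = 1) : rk R {a, b} ≤ 1 := by
  have hsub := rk_inter_add_rk_union_le' (M := R) {a, z} {b, z}
  have h1 : 1 ≤ rk R ({a, z} ∩ {b, z}) := by
    have hzz : z ∈ ({a, z} ∩ {b, z} : Finset α) :=
      mem_inter.2 ⟨mem_insert_of_mem (mem_singleton_self z), mem_insert_of_mem (mem_singleton_self z)⟩
    have h := hll z hz
    have := rk_mono' (M := R) (singleton_subset_iff.2 hzz)
    omega
  have h2 : rk R {a, b} ≤ rk R ({a, z} ∪ {b, z}) :=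
    rk_mono' (insert_subset (mem_union_left _ (mem_insert_self a {z}))
      (singleton_subset_iff.2 (mem_union_right _ (mem_insert_self b {z}))))
  omega

/-- A set of points all parallel to `c` has rank `≤ 1`. -/
theorem rk_le_one_of_all_parallel (hll : ∀ x ∈ gr R, rk R {x} = 1) {c : α} (hc : c ∈ gr R) {A : Finset α}
    (hA : A ⊆ gr R) (hpar : ∀ z ∈ A, rk R {c, z} = 1) : rk R A ≤ 1 := by
  have hsub : A ⊆ clF R {c} := by
    intro z hz
    rw [mem_clF_iff_rk_insert (hA hz) (singleton_subset_iff.2 hc), hll c hc]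
    have := hpar z hz
    rw [pair_comm] at this
    exact this
  have := rk_mono' (M := R) hsub
  rw [rk_clF, hll c hc] at this
  exact this

end Parallel

section BadCount

/-- **TWO BAD POINTS FORCE A PARALLEL**: for a basis `{a, b, c}` and a point `z`, if `{z, b, c}` and `{z, a, c}` both
have rank `≤ 2` then `z ∥ c`, and then `{z, a, b}` has rank `3`. -/
theorem two_bad_imp (hll : ∀ x ∈ gr R, rk R {x} = 1) (hR3 : rk R (gr R) = 3) {a b c z : α}
    (ha : a ∈ gr R) (hb : b ∈ gr R) (hc : c ∈ gr R) (hz : z ∈ gr R) (habc : rk R {a, b, c} = 3)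
    (h1 : rk R {z, b, c} ≤ 2) (h2 : rk R {z, a, c} ≤ 2) : rk R {c, z} = 1 ∧ rk R {z, a, b} = 3 := by
  have hsub := rk_inter_add_rk_union_le' (M := R) {z, b, c} {z, a, c}
  have hi : rk R {c, z} ≤ rk R ({z, b, c} ∩ {z, a, c}) := by
    apply rk_mono'
    intro x hx
    rw [mem_insert, mem_singleton] at hx
    rw [mem_inter, mem_insert, mem_insert, mem_singleton, mem_insert, mem_insert, mem_singleton]
    rcases hx with rfl | rfl <;> simp
  have hu : 3 ≤ rk R ({z, b, c} ∪ {z, a, c}) := by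
    rw [← habc]
    apply rk_mono'
    intro x hx
    rw [mem_insert, mem_insert, mem_singleton] at hx
    rw [mem_union, mem_insert, mem_insert, mem_singleton, mem_insert, mem_insert, mem_singleton]
    rcases hx with rfl | rfl | rfl <;> simp
  have hcz1 : 1 ≤ rk R {c, z} :=
    one_le_rk_of_mem_of_loopless hll (insert_subset hc (singleton_subset_iff.2 hz)) (mem_insert_self c {z})
  have hcz : rk R {c, z} = 1 := by omega
  refine ⟨hcz, ?_⟩
  have hins := rk_insert_eq_of_rk_pair_eq_one hll hz hc (by rw [pair_comm]; exact hcz)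
    (insert_subset hz (insert_subset ha (singleton_subset_iff.2 hb))) (mem_insert_self z {a, b})
  have h3 : 3 ≤ rk R (insert c {z, a, b}) := by
    rw [← habc]
    apply rk_mono'
    intro x hx
    rw [mem_insert, mem_insert, mem_singleton] at hx
    rw [mem_insert, mem_insert, mem_insert, mem_singleton]
    rcases hx with rfl | rfl | rfl <;> simp
  have h4 := hR3 ▸ rk_mono' (M := R) (insert_subset hz (insert_subset ha (singleton_subset_iff.2 hb)))
  omega

/-- For a point `z`, among `{z, g, k}`, `{z, f, k}`, `{z, f, g}` at least two are bases unless `z` is parallel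
to a point of the basis `{f, g, k}`, and at least one always — in indicator form. -/
theorem two_le_of_basis_triple (hll : ∀ x ∈ gr R, rk R {x} = 1) (hR3 : rk R (gr R) = 3) {f g k z : α}
    (hf : f ∈ gr R) (hg : g ∈ gr R) (hk : k ∈ gr R) (hz : z ∈ gr R) (hC : rk R {f, g, k} = 3) :
    2 ≤ (if rk R {z, g, k} = 3 then 1 else 0) + (if rk R {z, f, k} = 3 then 1 else 0) +
      (if rk R {z, f, g} = 3 then 1 else 0) +
      (if rk R {f, z} = 1 ∨ rk R {g, z} = 1 ∨ rk R {k, z} = 1 then 1 else 0) := by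
  have hle : ∀ X ⊆ gr R, rk R X ≤ 3 := fun X hX => hR3 ▸ rk_mono' hX
  have hfg : rk R {f, g, k} = 3 := hC
  have hgkf : rk R {g, k, f} = 3 := by
    rw [show ({g, k, f} : Finset α) = {f, g, k} by ext x; simp only [mem_insert, mem_singleton]; tauto]; exact hC
  have hkfg : rk R {k, f, g} = 3 := by
    rw [show ({k, f, g} : Finset α) = {f, g, k} by ext x; simp only [mem_insert, mem_singleton]; tauto]; exact hC
  have hfkg : rk R {f, k, g} = 3 := by
    rw [show ({f, k, g} : Finset α) = {f, g, k} by ext x; simp only [mem_insert, mem_singleton]; tauto]; exact hC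
  by_cases h1 : rk R {z, g, k} = 3 <;> by_cases h2 : rk R {z, f, k} = 3 <;> by_cases h3 : rk R {z, f, g} = 3 <;>
    simp only [h1, h2, h3, if_true, if_false]
  all_goals try omega
  · -- `{z, f, k}` and `{z, f, g}` bad (`a = g`, `b = k`, `c = f`): `z ∥ f`, and `{z, g, k}` is a basis — contradiction
    have hle1 := hle {z, f, k} (insert_subset hz (insert_subset hf (singleton_subset_iff.2 hk)))
    have hle2 := hle {z, f, g} (insert_subset hz (insert_subset hf (singleton_subset_iff.2 hg)))
    have := two_bad_imp hll hR3 (a := g) (b := k) (c := f) hg hk hf hz hgkf (by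
        rw [show ({z, k, f} : Finset α) = {z, f, k} by ext x; simp only [mem_insert, mem_singleton]; tauto]; omega)
      (by rw [show ({z, g, f} : Finset α) = {z, f, g} by ext x; simp only [mem_insert, mem_singleton]; tauto]; omega)
    rw [if_pos (Or.inl this.1)]
  · -- `{z, g, k}` and `{z, f, g}` bad (`a = f`, `b = k`, `c = g`): `z ∥ g`, `{z, f, k}` basis — contradiction
    have hle1 := hle {z, g, k} (insert_subset hz (insert_subset hg (singleton_subset_iff.2 hk)))
    have hle2 := hle {z, f, g} (insert_subset hz (insert_subset hf (singleton_subset_iff.2 hg)))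
    have := two_bad_imp hll hR3 (a := f) (b := k) (c := g) hf hk hg hz hfkg (by
        rw [show ({z, k, g} : Finset α) = {z, g, k} by ext x; simp only [mem_insert, mem_singleton]; tauto]; omega)
      (by omega)
    rw [if_pos (Or.inr (Or.inl this.1))]
  · -- `{z, g, k}` and `{z, f, k}` bad (`a = f`, `b = g`, `c = k`): `z ∥ k`, `{z, f, g}` basis — contradiction
    have hle1 := hle {z, g, k} (insert_subset hz (insert_subset hg (singleton_subset_iff.2 hk)))
    have hle2 := hle {z, f, k} (insert_subset hz (insert_subset hf (singleton_subset_iff.2 hk)))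
    have := two_bad_imp hll hR3 (a := f) (b := g) (c := k) hf hg hk hz hC (by omega) (by omega)
    rw [if_pos (Or.inr (Or.inr this.1))]
  · -- all three bad: impossible (`z ∥ k` from the last two, then `{z, f, g}` is a basis)
    have hle1 := hle {z, g, k} (insert_subset hz (insert_subset hg (singleton_subset_iff.2 hk)))
    have hle2 := hle {z, f, k} (insert_subset hz (insert_subset hf (singleton_subset_iff.2 hk)))
    have := two_bad_imp hll hR3 (a := f) (b := g) (c := k) hf hg hk hz hC (by omega) (by omega)
    exact absurd this.2 h3

end BadCount

section Families

variable {f g k : α}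

/-- The three-element set `{f, g, k}` of three distinct points has three elements. -/
theorem card_triple_of_ne (hfg : f ≠ g) (hfk : f ≠ k) (hgk : g ≠ k) : ({f, g, k} : Finset α).card = 3 :=
  card_eq_three.2 ⟨f, g, k, hfg, hfk, hgk, rfl⟩

/-- A triple with two points of the basis `{f, g, k}` and one point `z` outside it meets the basis in two points. -/
theorem card_inter_basis_two {z a b : α} (hz : z ∉ ({f, g, k} : Finset α))
    (ha : a ∈ ({f, g, k} : Finset α)) (hb : b ∈ ({f, g, k} : Finset α)) (hab : a ≠ b) :
    (({z, a, b} : Finset α) ∩ {f, g, k}).card = 2 := by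
  have e : ({z, a, b} : Finset α) ∩ {f, g, k} = {a, b} := by
    ext x
    simp only [mem_inter, mem_insert, mem_singleton]
    constructor
    · rintro ⟨h1, h2⟩
      rcases h1 with rfl | rfl | rfl
      · exact absurd (by simpa only [mem_insert, mem_singleton] using h2) hz
      · exact Or.inl rfl
      · exact Or.inr rfl
    · rintro (rfl | rfl)
      · exact ⟨Or.inr (Or.inl rfl), by simpa only [mem_insert, mem_singleton] using ha⟩
      · exact ⟨Or.inr (Or.inr rfl), by simpa only [mem_insert, mem_singleton] using hb⟩
  rw [e, card_pair hab]

/-- **FAMILY ONE**: the bi-spanning triples `C₀ − c + z` (`z` good), with `2·#good ≤ #T₁ + #par`. -/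
theorem exists_family_one (hll : ∀ x ∈ gr R, rk R {x} = 1) (hR3 : rk R (gr R) = 3)
    (hf : f ∈ gr R) (hg : g ∈ gr R) (hk : k ∈ gr R) (hfg : f ≠ g) (hfk : f ≠ k) (hgk : g ≠ k)
    (hC : rk R {f, g, k} = 3) :
    ∃ T₁ ⊆ ((gr R).powersetCard 3).filter (fun Y => rk R Y = 3 ∧ rk R (gr R \ Y) = 3),
      (∀ Y ∈ T₁, (Y ∩ {f, g, k}).card = 2) ∧
      2 * ((gr R \ {f, g, k}).filter (fun z => rk R ((gr R \ {f, g, k}).erase z) = 3)).card ≤ T₁.card +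
        (((gr R \ {f, g, k}).filter (fun z => rk R ((gr R \ {f, g, k}).erase z) = 3)).filter
          (fun z => rk R {f, z} = 1 ∨ rk R {g, z} = 1 ∨ rk R {k, z} = 1)).card := by
  obtain ⟨G, hG⟩ : ∃ G, G = (gr R \ {f, g, k}).filter (fun z => rk R ((gr R \ {f, g, k}).erase z) = 3) :=
    ⟨_, rfl⟩
  have hle : ∀ X ⊆ gr R, rk R X ≤ 3 := fun X hX => hR3 ▸ rk_mono' hX
  have hGmem : ∀ z ∈ G, z ∈ gr R ∧ z ∉ ({f, g, k} : Finset α) ∧ rk R ((gr R \ {f, g, k}).erase z) = 3 := by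
    intro z hz
    rw [hG, mem_filter, mem_sdiff] at hz
    exact ⟨hz.1.1, hz.1.2, hz.2⟩
  -- the generic member: `{z, a, b}` with `{a, b} ⊂ {f, g, k}` is bi-spanning when it spans
  have hmem : ∀ z ∈ G, ∀ a b, a ∈ ({f, g, k} : Finset α) → b ∈ ({f, g, k} : Finset α) → a ≠ b →
      rk R {z, a, b} = 3 →
      ({z, a, b} : Finset α) ∈ ((gr R).powersetCard 3).filter (fun Y => rk R Y = 3 ∧ rk R (gr R \ Y) = 3) := by
    intro z hz a b ha hb hab hr
    obtain ⟨hzE, hzC, hzg⟩ := hGmem z hz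
    have haE : a ∈ gr R := by
      simp only [mem_insert, mem_singleton] at ha; rcases ha with rfl | rfl | rfl <;> assumption
    have hbE : b ∈ gr R := by
      simp only [mem_insert, mem_singleton] at hb; rcases hb with rfl | rfl | rfl <;> assumption
    have hza : z ≠ a := fun h => hzC (h ▸ ha)
    have hzb : z ≠ b := fun h => hzC (h ▸ hb)
    rw [mem_filter, mem_powersetCard]
    refine ⟨⟨insert_subset hzE (insert_subset haE (singleton_subset_iff.2 hbE)), card_eq_three.2 ⟨z, a, b, hza, hzb, hab, rfl⟩⟩, hr, ?_⟩
    have hsub : (gr R \ {f, g, k}).erase z ⊆ gr R \ {z, a, b} := by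
      intro x hx
      rw [mem_erase, mem_sdiff] at hx
      rw [mem_sdiff, mem_insert, mem_insert, mem_singleton]
      refine ⟨hx.2.1, ?_⟩
      rintro (rfl | rfl | rfl)
      · exact hx.1 rfl
      · exact hx.2.2 ha
      · exact hx.2.2 hb
    have h1 := rk_mono' (M := R) hsub
    have h2 := hle _ (sdiff_subset : gr R \ {z, a, b} ⊆ gr R)
    omega
  refine ⟨(G.filter (fun z => rk R {z, g, k} = 3)).image (fun z => ({z, g, k} : Finset α)) ∪
      (G.filter (fun z => rk R {z, f, k} = 3)).image (fun z => ({z, f, k} : Finset α)) ∪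
      (G.filter (fun z => rk R {z, f, g} = 3)).image (fun z => ({z, f, g} : Finset α)), ?_, ?_, ?_⟩
  · -- `⊆ BS`
    intro Y hY
    rw [mem_union, mem_union, mem_image, mem_image, mem_image] at hY
    rcases hY with (⟨z, hz, rfl⟩ | ⟨z, hz, rfl⟩) | ⟨z, hz, rfl⟩
    · rw [mem_filter] at hz
      exact hmem z hz.1 g k (by simp) (by simp) hgk hz.2
    · rw [mem_filter] at hz
      exact hmem z hz.1 f k (by simp) (by simp) hfk hz.2
    · rw [mem_filter] at hz
      exact hmem z hz.1 f g (by simp) (by simp) hfg hz.2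
  · -- two points of the basis
    intro Y hY
    rw [mem_union, mem_union, mem_image, mem_image, mem_image] at hY
    rcases hY with (⟨z, hz, rfl⟩ | ⟨z, hz, rfl⟩) | ⟨z, hz, rfl⟩
    · exact card_inter_basis_two (hGmem z (mem_filter.1 hz).1).2.1 (by simp) (by simp) hgk
    · exact card_inter_basis_two (hGmem z (mem_filter.1 hz).1).2.1 (by simp) (by simp) hfk
    · exact card_inter_basis_two (hGmem z (mem_filter.1 hz).1).2.1 (by simp) (by simp) hfg
  · -- the count
    have hinj : ∀ (a b : α), a ≠ b → a ∈ ({f, g, k} : Finset α) → b ∈ ({f, g, k} : Finset α) →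
        Set.InjOn (fun z => ({z, a, b} : Finset α)) (G : Set α) := by
      intro a b _ ha hb z₁ hz₁ z₂ _ h
      have h₁ := (hGmem z₁ hz₁).2.1
      have h' : ({z₁, a, b} : Finset α) = {z₂, a, b} := h
      have : z₁ ∈ ({z₂, a, b} : Finset α) := by rw [← h']; exact mem_insert_self z₁ {a, b}
      rw [mem_insert, mem_insert, mem_singleton] at this
      rcases this with h' | rfl | rfl
      · exact h'
      · exact absurd ha h₁
      · exact absurd hb h₁
    have hd1 : Disjoint ((G.filter (fun z => rk R {z, g, k} = 3)).image (fun z => ({z, g, k} : Finset α)))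
        ((G.filter (fun z => rk R {z, f, k} = 3)).image (fun z => ({z, f, k} : Finset α))) := by
      rw [disjoint_left]
      intro Y hY₁ hY₂
      rw [mem_image] at hY₁ hY₂
      obtain ⟨z, hz, rfl⟩ := hY₁
      obtain ⟨z', hz', h⟩ := hY₂
      have : f ∈ ({z, g, k} : Finset α) := by rw [← h]; exact mem_insert_of_mem (mem_insert_self f {k})
      rw [mem_insert, mem_insert, mem_singleton] at this
      rcases this with h' | h' | h'
      · exact (hGmem z (mem_filter.1 hz).1).2.1 (h' ▸ mem_insert_self f {g, k})
      · exact hfg h'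
      · exact hfk h'
    have hd2 : Disjoint ((G.filter (fun z => rk R {z, g, k} = 3)).image (fun z => ({z, g, k} : Finset α)) ∪
          (G.filter (fun z => rk R {z, f, k} = 3)).image (fun z => ({z, f, k} : Finset α)))
        ((G.filter (fun z => rk R {z, f, g} = 3)).image (fun z => ({z, f, g} : Finset α))) := by
      rw [disjoint_left]
      intro Y hY₁ hY₂
      rw [mem_image] at hY₂
      obtain ⟨z', hz', rfl⟩ := hY₂
      rw [mem_union, mem_image, mem_image] at hY₁
      have hz'C := (hGmem z' (mem_filter.1 hz').1).2.1
      rcases hY₁ with ⟨z, hz, h⟩ | ⟨z, hz, h⟩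
      · have : k ∈ ({z', f, g} : Finset α) := by
          rw [← h]; exact mem_insert_of_mem (mem_insert_of_mem (mem_singleton_self k))
        rw [mem_insert, mem_insert, mem_singleton] at this
        rcases this with h' | h' | h'
        · exact hz'C (h' ▸ mem_insert_of_mem (mem_insert_of_mem (mem_singleton_self k)))
        · exact hfk h'.symm
        · exact hgk h'.symm
      · have : k ∈ ({z', f, g} : Finset α) := by
          rw [← h]; exact mem_insert_of_mem (mem_insert_of_mem (mem_singleton_self k))
        rw [mem_insert, mem_insert, mem_singleton] at this
        rcases this with h' | h' | h'
        · exact hz'C (h' ▸ mem_insert_of_mem (mem_insert_of_mem (mem_singleton_self k)))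
        · exact hfk h'.symm
        · exact hgk h'.symm
    rw [card_union_of_disjoint hd2, card_union_of_disjoint hd1,
      card_image_of_injOn ((hinj g k hgk (by simp) (by simp)).mono (by intro z hz; exact (mem_filter.1 hz).1)),
      card_image_of_injOn ((hinj f k hfk (by simp) (by simp)).mono (by intro z hz; exact (mem_filter.1 hz).1)),
      card_image_of_injOn ((hinj f g hfg (by simp) (by simp)).mono (by intro z hz; exact (mem_filter.1 hz).1))]
    -- pointwise: `two_le_of_basis_triple`, summed over `G`
    rw [← hG, card_filter, card_filter, card_filter, card_filter, ← sum_add_distrib, ← sum_add_distrib,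
      ← sum_add_distrib]
    have : ∀ z ∈ G, 2 ≤ (if rk R {z, g, k} = 3 then 1 else 0) + (if rk R {z, f, k} = 3 then 1 else 0) +
        (if rk R {z, f, g} = 3 then 1 else 0) +
        (if rk R {f, z} = 1 ∨ rk R {g, z} = 1 ∨ rk R {k, z} = 1 then 1 else 0) :=
      fun z hz => two_le_of_basis_triple hll hR3 hf hg hk (hGmem z hz).1 hC
    calc 2 * G.card = ∑ _z ∈ G, 2 := by rw [sum_const, smul_eq_mul, mul_comm]
      _ ≤ _ := sum_le_sum this

end Families

end PercRepro.Cogirth
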